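import Mathlib
import Literature.Computability.AlgebraicComplexity.BurgisserBooleanPartsModPCircuits
import HarnessLib

/-!
# Boolean gadgets for fixed-width signed (two's complement) words

Fixed-width signed arithmetic as `B₂`-straight-line programs, phrased in the bookkeeping device
`CktSizeVia` / `HasBits` of `BurgisserBooleanPartsModPCircuits.lean` with the modulus `2 ^ W`:
the two's complement word of width `W` of an integer `y` is the binary representation of
`(y : ZMod (2 ^ W)).val = y mod 2 ^ W` (Vollmer 1999, §1.3; Wegener 1987, Ch. 3), so that the tree's
modular adder and multiplier (`HasBits.add`, `HasBits.mul`) ARE two's complement addition and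
multiplication, exact whenever the true result fits the word (`Int.cast` is a ring map).  This file
adds the non-ring operations a fixed-point simulation needs:

* `CktSizeVia.anyList` — OR-reduction of a list of wires (`|L| + 1` gates);
* `HasBits.neg'`, `HasBits.sub'` — negation / subtraction (via the constant `-1`);
* `HasBits.natShiftRight` — logical right shift of a natural-number word (wiring + one constant);
* `HasBits.ashr` — ARITHMETIC right shift `y ↦ ⌊y / 2^B⌋` of a signed word with
  `|y| < 2^(W-1)`, by the offset trick `⌊y/2^B⌋ = ⌊(y + 2^(W-1))/2^B⌋ - 2^(W-1-B)` (two modular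
  additions of constants around a logical shift);
* `cktSizeVia_absLt` — the comparison bit `|y| < 2^M` (`M + 2 ≤ W`) of a signed word with
  `|y| < 2^(W-1)`, read off the word of `y + 2^M`: `|y| < 2^M ↔ 0 < (y + 2^M) mod 2^W < 2^(M+1)`,
  i.e. "some bit is set and no bit `≥ M+1` is set" (two OR-reductions);
* `HasBits.maskBy` — a word ANDed with a control bit (`c ? y : 0`).

All costs are explicit polynomials in `W` built from `modAddCost` / `modMulCost`.

## References

* H. Vollmer, *Introduction to Circuit Complexity*, Springer 1999, §1.1 (addition, comparison by
  circuits), §1.3 (binary and two's complement representation of integers). [cite: Vollmer1999, §1.3]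
* I. Wegener, *The Complexity of Boolean Functions*, Wiley–Teubner 1987, Ch. 3 (arithmetic circuits).
-/

noncomputable section

open Literature.Computability.AlgebraicComplexity

namespace Literature.Computability.AlgebraicComplexity

/-! ### Generic rows -/

section Generic

variable {θ α κ : Type*}

/-- OR-reduction of a list of wires of the bus: `1 + |L|` gates (a constant `false` and one
disjunction per wire; Vollmer 1999, §1.1). [cite: Vollmer1999, §1.1] -/
theorem CktSizeVia.anyList (e : θ → α → Bool) :
    ∀ L : List α, CktSizeVia e (fun t (_ : Unit) => L.any fun a => e t a) (1 + L.length)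
  | [] => by
    have h := CktSizeVia.constRow e (fun _ : Unit => false)
    rw [Fintype.card_unit] at h
    exact h.congr fun t => by simp
  | a :: L => by
    have ih := CktSizeVia.anyList e L
    have h := ih.extend.trans
      (CktSizeVia.binop (fun t => Sum.elim (e t) (fun _ : Unit => L.any fun a => e t a))
        (fun u v => u || v) (Sum.inl a) (Sum.inr ()))
    refine (h.congr fun t => ?_).of_le (by simp only [List.length_cons]; omega)
    funext u
    simp

/-- A row of wires ANDed with one control wire (`c ? row : 0`), one gate per output
(Vollmer 1999, §1.1). [cite: Vollmer1999, §1.1] -/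
theorem CktSizeVia.maskRow [Fintype κ] (e : θ → α → Bool) (c : α) (π : κ → α) :
    CktSizeVia e (fun t k => e t c && e t (π k)) (Fintype.card κ * 1) :=
  CktSizeVia.map₂ e (fun u v => u && v) (fun _ => c) π

end Generic

/-! ### Two's complement words: negation, subtraction, shifts -/

section Signed

variable {W : ℕ} {θ α : Type*} {e : θ → α → Bool} {s s' : ℕ}

/-- The modulus `2 ^ W` fits `W` bits. [folklore] -/
private theorem two_pow_le_two_pow_self (W : ℕ) : 2 ^ W ≤ 2 ^ W := le_rfl

/-- Negation of a residue (multiplication by the constant `-1`; two's complement negation,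
Vollmer 1999, §1.3). [cite: Vollmer1999, §1.3] -/
theorem HasBits.neg' {p ℓ : ℕ} [NeZero p] (hℓ : p ≤ 2 ^ ℓ) {v : θ → ZMod p}
    (hv : HasBits ℓ e v s) : HasBits ℓ e (fun t => -v t) (ℓ * 1 + s + modMulCost ℓ) :=
  ((HasBits.const ℓ e (-1 : ZMod p)).mul hℓ hv).congr fun t => by ring

/-- Subtraction of residues (two's complement subtraction, Vollmer 1999, §1.3). [cite: Vollmer1999, §1.3] -/
theorem HasBits.sub' {p ℓ : ℕ} [NeZero p] (hℓ : p ≤ 2 ^ ℓ) {u v : θ → ZMod p}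
    (hu : HasBits ℓ e u s) (hv : HasBits ℓ e v s') :
    HasBits ℓ e (fun t => u t - v t) (s + (ℓ * 1 + s' + modMulCost ℓ) + modAddCost ℓ) :=
  (hu.add hℓ (hv.neg' hℓ)).congr fun t => by ring

/-- Logical right shift of the word of a natural number `N < 2^W` by `B` places: wiring plus one
constant `false` feeding the vacated top positions (Vollmer 1999, §1.3). [cite: Vollmer1999, §1.3] -/
theorem HasBits.natShiftRight {N : θ → ℕ} (hN : ∀ t, N t < 2 ^ W)
    (h : HasBits W e (fun t => ((N t : ℕ) : ZMod (2 ^ W))) s) (B : ℕ) :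
    HasBits W e (fun t => ((N t / 2 ^ B : ℕ) : ZMod (2 ^ W))) (s + 1) := by
  have h1 := h.pair (CktSizeVia.of_cktSize (e := e) (f := fun _ (_ : Unit) => false)
    (Complexity.cktSize_const α false) fun _ => rfl)
  refine (h1.outMap fun i : Fin W =>
    if hi : (i : ℕ) + B < W then Sum.inl ⟨i + B, hi⟩ else Sum.inr ()).congr fun t => ?_
  funext i
  have hlt : N t / 2 ^ B < 2 ^ W := lt_of_le_of_lt (Nat.div_le_self _ _) (hN t)
  simp only [testBits_apply, ZMod.val_natCast, Nat.mod_eq_of_lt (hN t), Nat.mod_eq_of_lt hlt]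
  by_cases hi : (i : ℕ) + B < W
  · simp [hi, Nat.testBit_div_two_pow]
  · simp only [hi, ↓reduceDIte, Sum.elim_inr]
    rw [Nat.testBit_div_two_pow]
    exact (Nat.testBit_lt_two_pow ((hN t).trans_le (Nat.pow_le_pow_right (by norm_num) (by omega)))).symm

/-- The value of the two's complement word of `y` with `|y| < 2^(W-1)` shifted by the offset
`2^(W-1)` is the natural number `y + 2^(W-1) < 2^W`. [cite: Vollmer1999, §1.3] -/
theorem val_intCast_add_two_pow (hW : 1 ≤ W) {y : ℤ} (hy : |y| < 2 ^ (W - 1)) :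
    (((y : ZMod (2 ^ W)) + (2 ^ (W - 1) : ℕ)).val : ℤ) = y + 2 ^ (W - 1) ∧
      ((y : ZMod (2 ^ W)) + (2 ^ (W - 1) : ℕ)).val < 2 ^ W := by
  have hpow : (2 : ℤ) ^ W = 2 ^ (W - 1) * 2 := by
    rw [← pow_succ]; congr 1; omega
  rw [abs_lt] at hy
  refine ⟨?_, ZMod.val_lt _⟩
  have h1 : ((y : ZMod (2 ^ W)) + (2 ^ (W - 1) : ℕ)) = ((y + 2 ^ (W - 1) : ℤ) : ZMod (2 ^ W)) := by
    push_cast; ring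
  rw [h1, ZMod.val_intCast]
  push_cast
  exact Int.emod_eq_of_lt (by linarith) (by linarith)

/-- **Arithmetic right shift** of a two's complement word (Vollmer 1999, §1.3; Wegener 1987,
Ch. 3): if `|y| < 2^(W-1)` and `B < W`, the word of `⌊y / 2^B⌋` is computed from the word of
`y` by two modular additions of constants around a logical shift, using
`⌊y/2^B⌋ = ⌊(y + 2^(W-1))/2^B⌋ - 2^(W-1-B)`. [cite: Vollmer1999, §1.3] -/
theorem HasBits.ashr {y : θ → ℤ} {B : ℕ} (hB : B < W) (hy : ∀ t, |y t| < 2 ^ (W - 1))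
    (h : HasBits W e (fun t => ((y t : ℤ) : ZMod (2 ^ W))) s) :
    HasBits W e (fun t => ((y t / 2 ^ B : ℤ) : ZMod (2 ^ W)))
      (s + W * 1 + modAddCost W + 1 + W * 1 + modAddCost W) := by
  have hW : 1 ≤ W := by omega
  have hle := two_pow_le_two_pow_self W
  -- offset: `u = y + 2^(W-1)` as a natural-number word
  set N : θ → ℕ := fun t => (((y t : ZMod (2 ^ W)) + (2 ^ (W - 1) : ℕ)).val) with hN
  have hNlt : ∀ t, N t < 2 ^ W := fun t => (val_intCast_add_two_pow hW (hy t)).2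
  have hNval : ∀ t, (N t : ℤ) = y t + 2 ^ (W - 1) := fun t => (val_intCast_add_two_pow hW (hy t)).1
  have h1 : HasBits W e (fun t => ((N t : ℕ) : ZMod (2 ^ W))) (s + W * 1 + modAddCost W) :=
    (h.add hle (HasBits.const W e ((2 ^ (W - 1) : ℕ) : ZMod (2 ^ W)))).congr fun t => by
      simp only [hN, ZMod.natCast_val, ZMod.cast_id', id_eq]
  -- logical shift, then remove the shifted offset `2^(W-1-B)`
  have h2 := h1.natShiftRight hNlt B
  refine ((h2.add hle (HasBits.const W e (-((2 ^ (W - 1 - B) : ℕ) : ZMod (2 ^ W))))).congr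
    fun t => ?_).of_le (le_of_eq (by ring))
  -- the integer identity `⌊(y + 2^(W-1))/2^B⌋ = ⌊y/2^B⌋ + 2^(W-1-B)`
  have hdiv : ((N t / 2 ^ B : ℕ) : ℤ) = y t / 2 ^ B + 2 ^ (W - 1 - B) := by
    push_cast
    rw [hNval t]
    have hsplit : (2 : ℤ) ^ (W - 1) = 2 ^ (W - 1 - B) * 2 ^ B := by
      rw [← pow_add]; congr 1; omega
    rw [hsplit, Int.add_mul_ediv_right _ _ (by positivity)]
  have hcast : ((N t / 2 ^ B : ℕ) : ZMod (2 ^ W)) = (((N t / 2 ^ B : ℕ) : ℤ) : ZMod (2 ^ W)) :=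
    (Int.cast_natCast _).symm
  rw [hcast, hdiv]
  push_cast
  ring

/-! ### Comparison with a power of two and masking -/

/-- Arithmetic of the range test: for `|y| < 2^(W-1)` and `M + 2 ≤ W`,
`|y| < 2^M ↔ 0 < (y + 2^M) mod 2^W < 2^(M+1)` (stated over `ℤ`). [cite: Vollmer1999, §1.3] -/
theorem abs_lt_two_pow_iff_val {y : ℤ} {M : ℕ} (hM : M + 2 ≤ W) (hy : |y| < 2 ^ (W - 1)) :
    |y| < 2 ^ M ↔
      (0 : ℤ) < ((((y : ZMod (2 ^ W)) + (2 ^ M : ℕ)).val : ℕ) : ℤ) ∧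
        ((((y : ZMod (2 ^ W)) + (2 ^ M : ℕ)).val : ℕ) : ℤ) < 2 ^ (M + 1) := by
  have hval : ((((y : ZMod (2 ^ W)) + (2 ^ M : ℕ)).val : ℤ)) = (y + 2 ^ M) % 2 ^ W := by
    have h1 : ((y : ZMod (2 ^ W)) + (2 ^ M : ℕ)) = ((y + 2 ^ M : ℤ) : ZMod (2 ^ W)) := by
      push_cast; ring
    rw [h1, ZMod.val_intCast]; push_cast; ring_nf
  have h2W : (2 : ℤ) ^ W = 2 ^ (W - 2) * 4 := by
    rw [show (4 : ℤ) = 2 ^ 2 by norm_num, ← pow_add]; congr 1; omega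
  have h2W1 : (2 : ℤ) ^ (W - 1) = 2 ^ (W - 2) * 2 := by
    rw [← pow_succ]; congr 1; omega
  have hMle : (2 : ℤ) ^ M ≤ 2 ^ (W - 2) := pow_le_pow_right₀ (by norm_num) (by omega)
  have hM1 : (2 : ℤ) ^ (M + 1) = 2 ^ M * 2 := pow_succ _ _
  have hMpos : (0 : ℤ) < 2 ^ M := by positivity
  rw [abs_lt] at hy ⊢
  rw [hval]
  constructor
  · rintro ⟨h1, h2⟩
    rw [Int.emod_eq_of_lt (by linarith) (by linarith)]
    constructor <;> linarith
  · rintro ⟨h1, h2⟩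
    by_cases hv : 0 ≤ y + 2 ^ M
    · rw [Int.emod_eq_of_lt hv (by linarith)] at h1 h2
      constructor <;> linarith
    · push Not at hv
      have hmod : (y + 2 ^ M) % 2 ^ W = y + 2 ^ M + 2 ^ W := by
        rw [Int.emod_eq_add_self_emod, Int.emod_eq_of_lt (by linarith) (by linarith)]
      rw [hmod] at h2
      linarith

/-- Bits of the range test: a natural number `N < 2^W` satisfies `0 < N < 2^(M+1)` iff some
bit below `W` is set and no bit in `[M+1, W)` is set. [folklore] -/
private theorem pos_and_lt_two_pow_iff_testBit {N M : ℕ} (hN : N < 2 ^ W) :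
    ((0 : ℤ) < (N : ℤ) ∧ (N : ℤ) < 2 ^ (M + 1)) ↔
      ((List.finRange W).any fun i : Fin W => N.testBit i.val) = true ∧
        ((List.finRange W).any fun i : Fin W => decide (M + 1 ≤ i.val) && N.testBit i.val) = false := by
  have hcast : ((0 : ℤ) < (N : ℤ) ∧ (N : ℤ) < 2 ^ (M + 1)) ↔ (0 < N ∧ N < 2 ^ (M + 1)) := by
    constructor
    · rintro ⟨h1, h2⟩; exact ⟨by exact_mod_cast h1, by exact_mod_cast h2⟩
    · rintro ⟨h1, h2⟩; exact ⟨by exact_mod_cast h1, by exact_mod_cast h2⟩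
  rw [hcast]
  have hhigh : ∀ j, W ≤ j → N.testBit j = false := fun j hj =>
    Nat.testBit_lt_two_pow (hN.trans_le (Nat.pow_le_pow_right (by norm_num) hj))
  constructor
  · rintro ⟨h0, hM⟩
    constructor
    · obtain ⟨i, hi⟩ := Nat.exists_testBit_of_ne_zero (Nat.pos_iff_ne_zero.1 h0)
      have hiW : i < W := by
        by_contra hc
        rw [hhigh i (by omega)] at hi
        exact Bool.false_ne_true hi
      exact List.any_eq_true.2 ⟨⟨i, hiW⟩, List.mem_finRange _, hi⟩
    · refine List.any_eq_false.2 fun i _ => ?_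
      simp only [Bool.and_eq_true, decide_eq_true_eq, not_and]
      intro hi
      rw [Nat.testBit_lt_two_pow (hM.trans_le (Nat.pow_le_pow_right (by norm_num) hi))]
      exact Bool.false_ne_true
  · rintro ⟨h1, h2⟩
    obtain ⟨i, _, hi⟩ := List.any_eq_true.1 h1
    have h2' := List.any_eq_false.1 h2
    refine ⟨Nat.pos_of_ne_zero fun h => by simp [h] at hi, ?_⟩
    refine Nat.lt_pow_two_of_testBit _ fun j hj => ?_
    by_cases hjW : j < W
    · have := h2' ⟨j, hjW⟩ (List.mem_finRange _)
      simp only [Bool.and_eq_true, decide_eq_true_eq, not_and] at this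
      simpa using this hj
    · exact hhigh j (by omega)

/-- **Comparison bit `|y| < 2^M`** of a two's complement word with `|y| < 2^(W-1)` and
`M + 2 ≤ W` (Vollmer 1999, §1.1/§1.3: comparison circuits): add the constant `2^M` and test
"nonzero and below `2^(M+1)`" by two OR-reductions; `O(W²)` gates (the modular adder dominates). [cite: Vollmer1999, §1.3] -/
theorem cktSizeVia_absLt {y : θ → ℤ} {M : ℕ} (hM : M + 2 ≤ W) (hy : ∀ t, |y t| < 2 ^ (W - 1))
    (h : HasBits W e (fun t => ((y t : ℤ) : ZMod (2 ^ W))) s) :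
    CktSizeVia e (fun t (_ : Unit) => decide (|y t| < (2 : ℤ) ^ M))
      (s + W * 1 + modAddCost W + (3 * W + 3)) := by
  have hle := two_pow_le_two_pow_self W
  -- the word of `u = y + 2^M`
  set N : θ → ℕ := fun t => ((y t : ZMod (2 ^ W)) + ((2 ^ M : ℕ) : ZMod (2 ^ W))).val with hN
  have hu : HasBits W e (fun t => (y t : ZMod (2 ^ W)) + ((2 ^ M : ℕ) : ZMod (2 ^ W)))
      (s + W * 1 + modAddCost W) := h.add hle (HasBits.const W e _)
  have hNlt : ∀ t, N t < 2 ^ W := fun t => by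
    have hv := ZMod.val_lt ((y t : ZMod (2 ^ W)) + ((2 ^ M : ℕ) : ZMod (2 ^ W)))
    simpa [hN] using hv
  -- on the bus of that word: two OR-reductions and one gate
  set f : θ → Fin W → Bool := fun t => testBits W (N t) with hf
  have hu' : CktSizeVia e f (s + W * 1 + modAddCost W) := hu
  set L₁ : List (Fin W) := List.finRange W with hL₁
  set L₂ : List (Fin W) := (List.finRange W).filter fun i : Fin W => decide (M + 1 ≤ i.val) with hL₂
  have hlen₁ : L₁.length = W := List.length_finRange
  have hlen₂ : L₂.length ≤ W := (List.length_filter_le _ _).trans hlen₁.le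
  have hany := CktSizeVia.anyList f L₁
  have hhigh := CktSizeVia.anyList f L₂
  have hgate := (hany.pair hhigh).trans (CktSizeVia.binop
    (fun t => Sum.elim (fun _ : Unit => L₁.any fun a => f t a) (fun _ : Unit => L₂.any fun a => f t a))
    (fun a b => a && !b) (Sum.inl ()) (Sum.inr ()))
  refine ((hu'.trans hgate).congr fun t => ?_).of_le (by omega)
  funext u
  simp only [Sum.elim_inl, Sum.elim_inr]
  have key := (abs_lt_two_pow_iff_val (W := W) hM (hy t)).trans
    (pos_and_lt_two_pow_iff_testBit (M := M) (hNlt t))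
  have e₁ : (L₁.any fun a => f t a) = ((List.finRange W).any fun i : Fin W => (N t).testBit i.val) := by
    simp only [hL₁, hf, testBits_apply]
  have e₂ : (L₂.any fun a => f t a) =
      ((List.finRange W).any fun i : Fin W => decide (M + 1 ≤ i.val) && (N t).testBit i.val) := by
    simp only [hL₂, hf, List.any_filter, testBits_apply]
  rw [e₁, e₂]
  generalize ((List.finRange W).any fun i : Fin W => (N t).testBit i.val) = b₁ at key ⊢
  generalize ((List.finRange W).any fun i : Fin W => decide (M + 1 ≤ i.val) && (N t).testBit i.val) = b₂
    at key ⊢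
  by_cases hlt : |y t| < (2 : ℤ) ^ M
  · obtain ⟨h1, h2⟩ := key.1 hlt
    rw [decide_eq_true hlt, h1, h2]; rfl
  · rw [decide_eq_false hlt]
    have hne : ¬ (b₁ = true ∧ b₂ = false) := fun hb => hlt (key.2 hb)
    revert hne
    cases b₁ <;> cases b₂ <;> simp

/-- A word masked by a computed control bit: `c ? v : 0`, one AND gate per bit
(Vollmer 1999, §1.2: selection). [cite: Vollmer1999, §1.2] -/
theorem HasBits.maskBy {p ℓ sc : ℕ} [NeZero p] {v : θ → ZMod p} {c : θ → Bool}
    (hv : HasBits ℓ e v s) (hc : CktSizeVia e (fun t (_ : Unit) => c t) sc) :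
    HasBits ℓ e (fun t => if c t then v t else 0) (s + sc + ℓ * 1) := by
  have h := (hv.pair hc).trans (CktSizeVia.maskRow
    (fun t => Sum.elim (testBits ℓ (v t).val) (fun _ : Unit => c t)) (Sum.inr ()) Sum.inl)
  refine (h.congr fun t => ?_).of_le (by simp)
  funext i
  by_cases hc : c t <;> simp [hc]

/-- Conjunction of two computed control bits (one binary gate; Vollmer 1999, §1.1). [cite: Vollmer1999, §1.1] -/
theorem CktSizeVia.and_bit {c d : θ → Bool} {sc sd : ℕ}
    (hc : CktSizeVia e (fun t (_ : Unit) => c t) sc) (hd : CktSizeVia e (fun t (_ : Unit) => d t) sd) :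
    CktSizeVia e (fun t (_ : Unit) => (c t && d t)) (sc + sd + 1) :=
  ((hc.pair hd).trans (CktSizeVia.binop (fun t => Sum.elim (fun _ : Unit => c t) (fun _ : Unit => d t))
    (fun a b => a && b) (Sum.inl ()) (Sum.inr ()))).congr fun t => by funext u; simp

end Signed

end Literature.Computability.AlgebraicComplexity

end
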